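import Summits.QuantumFields.YangMills.Theorems.SwapVirialDeficitSectorLaplaceTipFibreFloor
import Summits.QuantumFields.YangMills.Theorems.SwapVirialDeficitBlowUpGnomonicAlignedFrameLetters
import Summits.QuantumFields.YangMills.Theorems.SwapVirialDeficitBlowUpGnomonicApexSoftLine
import Summits.QuantumFields.YangMills.Theorems.SwapVirialDeficitBlowUpGnomonicLeaderGroupDistApex
import HarnessLib

/-!
# Route `SwapVirialDeficit` (YangMills): THE PX POINTWISE MAJORANT OF THE TIP FIBRE (hCore, aligned frame (B8), F4-PX)
# (cell ym-idea-1, skeleton ➎, `stub_core_tip`, the core; free-hands support of ⟨stmt-QuantumFields-24197⟩ `SwapVirialDeficit.SwapGluedStiffness`)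

The aligned frame of record (LEAD g100 (B8), memo `w2-g61-memo-hCore-S3S4-aligned.md`): over a leader point `ℓ = ((x,y),(z,0))` with `x ≠ 0`
take the unit quaternion `u` with `rot3 u e₀ = x̂` (✓`exists_rot3_e0_eq`), so that `X := rot3 ū x = (|x|,0,0)` EXACTLY (✓`rot3_star_self_axis`),
`Y := rot3 ū y` has `Y₀ = x·y∕|x|` (✓`rot3_star_other_axial`) and `Y₁²+Y₂² = |x×y|²∕|x|²` (✓`rot3_star_other_transverse_sq`); the REFERENCE BASE
POINT is `p′ := (|x|, x·y∕|x|)`.  The group-distance window of ✓`tipFibre_le_four_cross` is then δt-FREE: for a T1-admissible `ℓ` (`F̂(ℓ) ≤ κf`)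
✓`tip_four_floor` gives `|z|²∕(1+|z|²) ≤ θ² = 7200L⁶κf`, ✓`gnoDeficit_floor_cross` gives `Cross = 4|x×y|²∕((1+|x|²)(1+|y|²)) ≤ θ′² = 1800L⁶κf`, whence
(✓`leaderGroupDist_le_apex` at `(X,Y,Z)`, first term `0`) `D ≤ √(2θ²) + √(2θ′)` (`2(Y₁²+Y₂²)∕(1+|Y|²) ≤ 2θ′` by the case split `|x|² ≷ θ′`).
★★★ `tipPX_pointwise` — for good `ε`, `δt ≥ 1` in the angle window, any follower-Hessian family `A₀` at the apex hub, `x ≠ 0`, T1 constants, and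
`√(2θ²) + √(2θ′) ≤ ω₀ := μ_F∕(4·(3|Fol|))∕(3219264L⁴)`, `θ² ≤ 1∕2`:
`∫⁻_F e^{−bF̂(hubAt δt 1, ε, ((x,y),(z,F)))}·piWeight F ≤ ofReal( e^{−(b∕14400L⁶)·2s²|x⊥|²∕(1+|x|²)} · e^{−(b∕28800L⁶)·|z|²} · e^{−(b∕3600L⁶)·Cross(x,y)} ·
   (e^{3∕2}·G_b∕√det A₀(gnoBase |x| (x·y∕|x|)) + e^{−bκ_R}·I_W) ) + ofReal(e^{−bκ_far})·∫⁻ piWeight`  (`s² = (1+δt²)⁻¹`)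
— the near branch by ✓`tipFibre_le_four_cross` (its floor weakened: `4δt²s⁴ ≥ 2s²`, Term2 ≥ 0, partial cross ≥ 0, `|z|²∕(1+|z|²) ≥ |z|²∕2` as `|z|² ≤ 1`),
the far branch by ✓`tipCore_fibre_far`.  Of the region PX only `|y| ≤ |x|` is used (for the window when `|x|² < θ′`); `s < |x|` matters only in F5.

HONEST LABEL: one pointwise brick; F5 (the PX integral), ORIG, the merge, hence hCore ∕ `stub_core_tip` ∕ ⟨24197⟩ ∕ ⟨24194⟩ remain OPEN; own crux ⟨22884⟩
`LargeFieldMassRefinementTail` OPEN (blocked-on ⟨19935⟩); the Yang–Mills mass gap is NOT proved; no summit is proved by a line.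
THEOREMS ONLY (0 `def`, 0 `sorry`, no instance), standard axioms.  Width seat ym-line-sfw-p2-w2 g61 (cell ym-idea-1, free hands), `--supports stmt-QuantumFields-24197`.
References: [cite: Luscher1983, §2]; [cite: Breitung1994, Lemma 26]; [folklore].
-/

set_option autoImplicit false
set_option synthInstance.maxSize 1024

noncomputable section

open MeasureTheory Quaternion Set Module
open scoped Quaternion BigOperators ENNReal InnerProductSpace
open Literature.MathematicalPhysics.QuantumLattice
open Literature.MathematicalPhysics.QuantumFieldTheory hiding SU2

namespace Summit.QuantumFields.YangMills.Theorems.SwapVirialDeficit.SectorLaplace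

open Summit.QuantumFields.YangMills.Theorems.FemtoTransferGap
open Summit.QuantumFields.YangMills.Theorems.FemtoTransferGap.TT
open Summit.QuantumFields.YangMills.Theorems.VirialFluxGap.RingDeficit
open Summit.QuantumFields.YangMills.Theorems.SwapVirialDeficit.SwapRing
open Summit.QuantumFields.YangMills.Theorems.SwapVirialDeficit.BlowUpRing
open Summit.QuantumFields.YangMills.Theorems.SwapVirialDeficit.Gnomonic (piWeight piWeight_pos piWeight_le_one normSq3 normSq3_smul normSq3_nonneg)

variable {L : ℕ} [NeZero L]

/-! ## §1 Letter facts of the aligned frame -/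

omit [NeZero L] in
/-- `gnoRot ū ((x,y),(z,0)) = ((rot3 ū x, rot3 ū y), (rot3 ū z, 0))`. [folklore] -/
theorem gnoRot_leaderPoint (u : ℍ) (x y z : Fin 3 → ℝ) :
    gnoRot u ((((x, y), (z, (0 : Fol L → Fin 3 → ℝ))) : GnoCoord L)) = (((rot3 u x, rot3 u y), (rot3 u z, (0 : Fol L → Fin 3 → ℝ))) : GnoCoord L) := by
  show (((rot3 u x, rot3 u y), (rot3 u z, fun f => rot3 u ((0 : Fol L → Fin 3 → ℝ) f))) : GnoCoord L) = _
  congr 2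
  funext f
  exact rot3_zero u

omit [NeZero L] in
/-- The base point over `(X 0, Y 0)` in the spelling of ✓`leaderGroupDist_le_apex`. [folklore] -/
theorem gnoBase_eq_leaders (a c : ℝ) :
    gnoBase (L := L) a c = ((((![a, 0, 0] : Fin 3 → ℝ), (![c, 0, 0] : Fin 3 → ℝ)), ((0 : Fin 3 → ℝ), (0 : Fol L → Fin 3 → ℝ))) : GnoCoord L) := rfl

/-- The unit vector `x̂ = |x|⁻¹x` has `normSq3 = 1`. [folklore] -/
theorem normSq3_unit {x : Fin 3 → ℝ} (hx : 0 < normSq3 x) : normSq3 ((Real.sqrt (normSq3 x))⁻¹ • x) = 1 := by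
  rw [normSq3_smul, inv_pow, Real.sq_sqrt hx.le, inv_mul_cancel₀ hx.ne']

/-- The compressed transverse size of the other leader in the window: if `Cross = 4|x|²T∕((1+|x|²)(1+|y|²)) ≤ θ′²` (`T = Y₁²+Y₂² ≤ |y|²`, here only
`T·|x|² = |x×y|²`-shaped facts are used abstractly) then `2T∕(1+|y|²) ≤ 2θ′` for `0 < θ′ ≤ 1`. [folklore] -/
theorem transverse_window_of_cross {N M T θ' : ℝ} (hN : 0 < N) (hM : 0 ≤ M) (hT0 : 0 ≤ T) (hTM : T ≤ M) (hMN : M ≤ N) (hθ0 : 0 < θ') (hθ1 : θ' ≤ 1)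
    (hcross : 4 * (N * T) / ((1 + N) * (1 + M)) ≤ θ' ^ 2) : 2 * T / (1 + M) ≤ 2 * θ' := by
  rw [div_le_iff₀ (by positivity)] at hcross ⊢
  by_cases hNθ : θ' ≤ N
  · -- `T/(1+M) ≤ θ′²(1+N)/(4N) ≤ θ′/2·(1+N)θ′/(2N)`, and `θ′(1+N) ≤ 2N` when `θ′ ≤ N`, `θ′ ≤ 1`
    nlinarith [mul_nonneg hT0 hN.le, mul_nonneg (sub_nonneg.2 hNθ) hθ0.le, mul_nonneg (sub_nonneg.2 hθ1) hN.le]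
  · push Not at hNθ
    nlinarith

/-- `2s² ≤ 4δ²s⁴` for `δ ≥ 1`, `s² = (1+δ²)⁻¹` (Term1's coefficient dominates the soft one). [folklore] -/
theorem two_sSq_le_four_deltaSq_sSq_sq {δ : ℝ} (hδ : 1 ≤ δ) : 2 * (1 + δ ^ 2)⁻¹ ≤ 4 * δ ^ 2 * ((1 + δ ^ 2)⁻¹) ^ 2 := by
  have h0 : 0 < 1 + δ ^ 2 := by positivity
  have hδ2 : 1 ≤ δ ^ 2 := one_le_pow₀ hδ
  rw [inv_pow, ← div_eq_mul_inv, ← div_eq_mul_inv, div_le_div_iff₀ h0 (by positivity)]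
  nlinarith [mul_nonneg h0.le (sub_nonneg.2 hδ2)]

/-! ## §2 The PX pointwise majorant -/

set_option maxHeartbeats 1600000 in
/-- ★★★ **THE PX POINTWISE MAJORANT** (aligned frame; see the file header). [cite: Luscher1983, §2] [cite: Breitung1994, Lemma 26] -/
theorem tipPX_pointwise {ε : GnoSign L} (hε : GoodSign ε) {δt : ℝ} (hδt : 1 ≤ δt)
    (hwinδ : 122689728 * δt⁻¹ * (L : ℝ) ^ 4 ≤ (2304 * (L : ℝ) ^ 6 * (Fintype.card (Fol L) : ℝ))⁻¹ / (8 * (3 * (Fintype.card (Fol L) : ℝ))))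
    {A0 : GnoCoord L → GnoFol L →ₗ[ℝ] GnoFol L} (hA0s : ∀ η, (A0 η).IsSymmetric)
    (hA0yy : ∀ η (y : GnoFol L), ⟪A0 η y, y⟫_ℝ = iteratedFDeriv ℝ 2 (fun y' : GnoFol L => gnoDeficit z₀ (fun _ => 1) ((1 : ℝ) : ℍ) ε (η + gnoFolEmb y')) 0 (fun _ => y))
    (hA0ray : ∀ η (y : GnoFol L), ⟪A0 η y, y⟫_ℝ = iteratedDeriv 2 (fun s : ℝ => gnoDeficit (fun _ => false) (fun _ => 1) ((1 : ℝ) : ℍ) ε (η + s • gnoFolEmb y)) 0)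
    (hA0amb : ∀ η (y : GnoFol L), ⟪A0 η y, y⟫_ℝ = iteratedFDeriv ℝ 2 (gnoDeficit z₀ (fun _ => 1) ((1 : ℝ) : ℍ) ε) η (fun _ => gnoFolEmb y))
    (x y z : Fin 3 → ℝ) (hx : 0 < (x 0) ^ 2 + (x 1) ^ 2 + (x 2) ^ 2) (hyx : (y 0) ^ 2 + (y 1) ^ 2 + (y 2) ^ 2 ≤ (x 0) ^ 2 + (x 1) ^ 2 + (x 2) ^ 2)
    {sT κf : ℝ} (hsT : 0 ≤ sT) (hκf0 : 0 < κf)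
    (hs2 : sT ^ 2 ≤ ((2304 * (L : ℝ) ^ 6 * (Fintype.card (Fol L) : ℝ))⁻¹) ^ 2 / (304992000000 * (L : ℝ) ^ 8))
    (hκf : κf ≤ (2304 * (L : ℝ) ^ 6 * (Fintype.card (Fol L) : ℝ))⁻¹ * ((2304 * (L : ℝ) ^ 6 * (Fintype.card (Fol L) : ℝ))⁻¹ / (6 * (2484000 * (L : ℝ) ^ 4))) ^ 2 / 4)
    (hκwin : 44712000 * (L : ℝ) ^ 4 * Real.sqrt (κf / (2304 * (L : ℝ) ^ 6 * (Fintype.card (Fol L) : ℝ))⁻¹) ≤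
      (2304 * (L : ℝ) ^ 6 * (Fintype.card (Fol L) : ℝ))⁻¹ / (8 * (3 * (Fintype.card (Fol L) : ℝ))))
    (hθhalf : 7200 * (L : ℝ) ^ 6 * κf ≤ 1 / 2)
    (hθwin : Real.sqrt (2 * (7200 * (L : ℝ) ^ 6 * κf)) + Real.sqrt (2 * Real.sqrt (1800 * (L : ℝ) ^ 6 * κf)) ≤
      (2304 * (L : ℝ) ^ 6 * (Fintype.card (Fol L) : ℝ))⁻¹ / (4 * (3 * (Fintype.card (Fol L) : ℝ))) / (3219264 * (L : ℝ) ^ 4))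
    {b : ℝ} (hb : 0 < b) :
    ∫⁻ F : Fol L → Fin 3 → ℝ, ENNReal.ofReal (Real.exp (-(b * gnoDeficit (fun _ => false) (fun _ => 1) (hubAt δt 1) ε (((x, y), (z, F)) : GnoCoord L))) * piWeight F) ≤
      ENNReal.ofReal (Real.exp (-(b / (14400 * (L : ℝ) ^ 6) * (2 * (1 + δt ^ 2)⁻¹ * ((x 1) ^ 2 + (x 2) ^ 2) / (1 + ((x 0) ^ 2 + (x 1) ^ 2 + (x 2) ^ 2))))) *
          Real.exp (-(b / (28800 * (L : ℝ) ^ 6) * ((z 0) ^ 2 + (z 1) ^ 2 + (z 2) ^ 2))) *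
          Real.exp (-(b / (3600 * (L : ℝ) ^ 6) * (4 * ((x 1 * y 2 - x 2 * y 1) ^ 2 + (x 2 * y 0 - x 0 * y 2) ^ 2 + (x 0 * y 1 - x 1 * y 0) ^ 2) /
            ((1 + ((x 0) ^ 2 + (x 1) ^ 2 + (x 2) ^ 2)) * (1 + ((y 0) ^ 2 + (y 1) ^ 2 + (y 2) ^ 2)))))) *
          (Real.exp (3 / 2) * (2 * Real.pi / ((1 - 1 / (2 * (finrank ℝ (GnoFol L) : ℝ))) * b)) ^ ((finrank ℝ (GnoFol L) : ℝ) / 2) /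
              Real.sqrt (LinearMap.det (A0 (gnoBase (Real.sqrt ((x 0) ^ 2 + (x 1) ^ 2 + (x 2) ^ 2))
                ((Real.sqrt ((x 0) ^ 2 + (x 1) ^ 2 + (x 2) ^ 2))⁻¹ * (x 0 * y 0 + x 1 * y 1 + x 2 * y 2))))) +
            Real.exp (-(b * ((2304 * (L : ℝ) ^ 6 * (Fintype.card (Fol L) : ℝ))⁻¹ *
                (3 * ((2304 * (L : ℝ) ^ 6 * (Fintype.card (Fol L) : ℝ))⁻¹ / 2) / (2 * (finrank ℝ (GnoFol L) : ℝ) * (2484000 * (L : ℝ) ^ 4))) ^ 2 / 4))) *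
              ∫ w : GnoFol L, piWeight (gnoFolBlocks w))) +
        ENNReal.ofReal (Real.exp (-(b * (min (sT ^ 2) (κf / (300 * (L : ℝ) ^ 4)) / (3600 * (L : ℝ) ^ 6))))) *
          ∫⁻ F : Fol L → Fin 3 → ℝ, ENNReal.ofReal (piWeight F) := by
  have hL : (0 : ℝ) < (L : ℝ) := Nat.cast_pos.2 (Nat.pos_of_ne_zero (NeZero.ne L))
  have hδt0 : 0 < δt := by linarith only [hδt]
  set ℓ : GnoCoord L := (((x, y), (z, (0 : Fol L → Fin 3 → ℝ))) : GnoCoord L) with hℓ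
  -- abbreviations for the right-hand side
  set Nx : ℝ := (x 0) ^ 2 + (x 1) ^ 2 + (x 2) ^ 2 with hNx
  set Ny : ℝ := (y 0) ^ 2 + (y 1) ^ 2 + (y 2) ^ 2 with hNy
  set Nz : ℝ := (z 0) ^ 2 + (z 1) ^ 2 + (z 2) ^ 2 with hNz
  set Cr : ℝ := 4 * ((x 1 * y 2 - x 2 * y 1) ^ 2 + (x 2 * y 0 - x 0 * y 2) ^ 2 + (x 0 * y 1 - x 1 * y 0) ^ 2) / ((1 + Nx) * (1 + Ny)) with hCr
  set μ : ℝ := (2304 * (L : ℝ) ^ 6 * (Fintype.card (Fol L) : ℝ))⁻¹ with hμ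
  set Gb : ℝ := (2 * Real.pi / ((1 - 1 / (2 * (finrank ℝ (GnoFol L) : ℝ))) * b)) ^ ((finrank ℝ (GnoFol L) : ℝ) / 2) with hGb
  set κR : ℝ := μ * (3 * (μ / 2) / (2 * (finrank ℝ (GnoFol L) : ℝ) * (2484000 * (L : ℝ) ^ 4))) ^ 2 / 4 with hκR
  set IW : ℝ := ∫ w : GnoFol L, piWeight (gnoFolBlocks w) with hIW
  set p' : ℝ × ℝ := (Real.sqrt Nx, (Real.sqrt Nx)⁻¹ * (x 0 * y 0 + x 1 * y 1 + x 2 * y 2)) with hp'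
  set Kn : ℝ := Real.exp (3 / 2) * Gb / Real.sqrt (LinearMap.det (A0 (gnoBase p'.1 p'.2))) + Real.exp (-(b * κR)) * IW with hKn
  set Tfar : ℝ≥0∞ := ENNReal.ofReal (Real.exp (-(b * (min (sT ^ 2) (κf / (300 * (L : ℝ) ^ 4)) / (3600 * (L : ℝ) ^ 6))))) *
    ∫⁻ F : Fol L → Fin 3 → ℝ, ENNReal.ofReal (piWeight F) with hTfar
  show ∫⁻ F : Fol L → Fin 3 → ℝ, ENNReal.ofReal (Real.exp (-(b * gnoDeficit (fun _ => false) (fun _ => 1) (hubAt δt 1) ε (((x, y), (z, F)) : GnoCoord L))) * piWeight F) ≤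
      ENNReal.ofReal (Real.exp (-(b / (14400 * (L : ℝ) ^ 6) * (2 * (1 + δt ^ 2)⁻¹ * ((x 1) ^ 2 + (x 2) ^ 2) / (1 + Nx)))) *
          Real.exp (-(b / (28800 * (L : ℝ) ^ 6) * Nz)) * Real.exp (-(b / (3600 * (L : ℝ) ^ 6) * Cr)) * Kn) + Tfar
  -- nonnegativity of the near constant
  obtain ⟨hWm, hWpos, hWle, hWint⟩ := folWeight_facts (L := L)
  have hIW0 : 0 ≤ IW := by rw [hIW]; exact integral_nonneg fun w => (hWpos w).le
  have hd9 := nine_le_finrank_gnoFol (L := L)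
  have hd1 : 0 < 1 - 1 / (2 * (finrank ℝ (GnoFol L) : ℝ)) := by rw [sub_pos, div_lt_one (by positivity)]; linarith only [hd9]
  have hGb0 : 0 ≤ Gb := by rw [hGb]; exact Real.rpow_nonneg (div_nonneg (by positivity) (mul_nonneg hd1.le hb.le)) _
  have hKn0 : 0 ≤ Kn := by rw [hKn]; positivity
  -- the window
  set ω₀ : ℝ := μ / (4 * (3 * (Fintype.card (Fol L) : ℝ))) / (3219264 * (L : ℝ) ^ 4) with hω₀
  obtain ⟨hμ0, hμle⟩ := folMu_pos_le (L := L)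
  obtain ⟨hN0, hN6, -⟩ := card_fol_facts (L := L)
  have hω0 : 0 < ω₀ := by positivity
  have hω1 : ω₀ ≤ 1 := by
    rw [hω₀, div_le_one (by positivity), div_le_iff₀ (by positivity)]
    have hcard : (1 : ℝ) ≤ (Fintype.card (Fol L) : ℝ) := by exact_mod_cast one_le_card_fol (L := L)
    have hμ1 : μ ≤ 1 := by
      rw [hμ]; refine inv_le_one_of_one_le₀ ?_
      have h6 : (1 : ℝ) ≤ (L : ℝ) ^ 6 := one_le_pow₀ (by exact_mod_cast NeZero.one_le)
      nlinarith only [h6, hcard]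
    have h4 : (1 : ℝ) ≤ (L : ℝ) ^ 4 := one_le_pow₀ (by exact_mod_cast NeZero.one_le)
    nlinarith only [h4, hcard, hμ1, hμ0]
  have hDwin : 3219264 * (L : ℝ) ^ 4 * ω₀ ≤ μ / (4 * (3 * (Fintype.card (Fol L) : ℝ))) := by
    rw [hω₀, mul_div_cancel₀ _ (by positivity)]
  -- the near ∕ far split
  by_cases hadm : ((∀ μ' ν : Fin 3, frobNorm ((((blowUpPoint 1 (gnomonicPoint (hubAt δt 1) ε ℓ)).1 (Fin.castSucc μ') *
        (blowUpPoint 1 (gnomonicPoint (hubAt δt 1) ε ℓ)).1 (Fin.castSucc ν) : SU2) : Matrix (Fin 2) (Fin 2) ℂ) -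
        (((blowUpPoint 1 (gnomonicPoint (hubAt δt 1) ε ℓ)).1 (Fin.castSucc ν) * (blowUpPoint 1 (gnomonicPoint (hubAt δt 1) ε ℓ)).1 (Fin.castSucc μ') : SU2) :
        Matrix (Fin 2) (Fin 2) ℂ)) ≤ sT) ∧
      (∀ μ' : Fin 3, frobNorm ((((blowUpPoint 1 (gnomonicPoint (hubAt δt 1) ε ℓ)).1 (Fin.last 3) *
        (blowUpPoint 1 (gnomonicPoint (hubAt δt 1) ε ℓ)).1 (Fin.castSucc (Equiv.swap (0 : Fin 3) 1 μ')) : SU2) : Matrix (Fin 2) (Fin 2) ℂ) -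
        (((blowUpPoint 1 (gnomonicPoint (hubAt δt 1) ε ℓ)).1 (Fin.castSucc μ') * (blowUpPoint 1 (gnomonicPoint (hubAt δt 1) ε ℓ)).1 (Fin.last 3) : SU2) : Matrix (Fin 2) (Fin 2) ℂ)) ≤ sT) ∧
      gnoDeficit (fun _ => false) (fun _ => 1) (hubAt δt 1) ε ℓ ≤ κf)
  swap
  · -- FAR
    have hfar := tipCore_fibre_far (L := L) (a := hubAt δt 1) ε hε.2 x y z hsT hκf0.le hb.le hadm
    exact hfar.trans le_add_self
  -- NEAR: the floors are small at `ℓ`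
  obtain ⟨-, -, hflat⟩ := hadm
  have hfour : 4 * δt ^ 2 * ((1 + δt ^ 2)⁻¹) ^ 2 * ((x 1) ^ 2 + (x 2) ^ 2) / (1 + Nx) +
          4 * (1 + δt ^ 2)⁻¹ * ((y 1) ^ 2 + (y 2) ^ 2) / (1 + Ny) +
          4 * ((x 2 * y 0 - x 0 * y 2) ^ 2 + (x 0 * y 1 - x 1 * y 0) ^ 2) / ((1 + Nx) * (1 + Ny)) + Nz / (1 + Nz) ≤
      7200 * (L : ℝ) ^ 6 * gnoDeficit (fun _ => false) (fun _ => 1) (hubAt δt 1) ε ℓ :=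
    tip_four_floor (L := L) δt ε ℓ
  have hcross : Cr ≤ 1800 * (L : ℝ) ^ 6 * gnoDeficit (fun _ => false) (fun _ => 1) (hubAt δt 1) ε ℓ :=
    gnoDeficit_floor_cross (L := L) (hubAt δt 1) ε ℓ
  set θ2 : ℝ := 7200 * (L : ℝ) ^ 6 * κf with hθ2
  set θ' : ℝ := Real.sqrt (1800 * (L : ℝ) ^ 6 * κf) with hθ'
  have hθ'0 : 0 < θ' := Real.sqrt_pos.2 (by positivity)
  have hθ'sq : θ' ^ 2 = 1800 * (L : ℝ) ^ 6 * κf := Real.sq_sqrt (by positivity)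
  have hθ'1 : θ' ≤ 1 := by
    rw [hθ', Real.sqrt_le_one]; nlinarith only [pow_pos hL 6, hκf0, hθhalf]
  have ht1 : 0 ≤ 4 * δt ^ 2 * ((1 + δt ^ 2)⁻¹) ^ 2 * ((x 1) ^ 2 + (x 2) ^ 2) / (1 + Nx) := by positivity
  have ht2 : 0 ≤ 4 * (1 + δt ^ 2)⁻¹ * ((y 1) ^ 2 + (y 2) ^ 2) / (1 + Ny) := by positivity
  have ht3 : 0 ≤ 4 * ((x 2 * y 0 - x 0 * y 2) ^ 2 + (x 0 * y 1 - x 1 * y 0) ^ 2) / ((1 + Nx) * (1 + Ny)) := by positivity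
  have hNz0 : 0 ≤ Nz := by positivity
  have hL6 : 0 < (L : ℝ) ^ 6 := pow_pos hL 6
  have hzt : Nz / (1 + Nz) ≤ θ2 := by
    have h1 : Nz / (1 + Nz) ≤ 7200 * (L : ℝ) ^ 6 * gnoDeficit (fun _ => false) (fun _ => 1) (hubAt δt 1) ε ℓ := by linarith only [hfour, ht1, ht2, ht3]
    have h2 : 7200 * (L : ℝ) ^ 6 * gnoDeficit (fun _ => false) (fun _ => 1) (hubAt δt 1) ε ℓ ≤ 7200 * (L : ℝ) ^ 6 * κf :=
      mul_le_mul_of_nonneg_left hflat (by positivity)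
    rw [hθ2]; exact h1.trans h2
  have hNz1 : Nz ≤ 1 := by
    have h : Nz / (1 + Nz) ≤ 1 / 2 := hzt.trans hθhalf
    rw [div_le_div_iff₀ (by positivity) (by norm_num)] at h
    linarith only [h, hNz0]
  have hCrθ : Cr ≤ θ' ^ 2 := by
    rw [hθ'sq]
    exact hcross.trans (mul_le_mul_of_nonneg_left hflat (by positivity))
  -- the aligned rotation
  have hxN : 0 < normSq3 x := by rw [normSq3_eq_three']; exact hx
  have hNxe : normSq3 x = Nx := normSq3_eq_three' x
  obtain ⟨u, hu, hrot⟩ := exists_rot3_e0_eq _ (normSq3_unit hxN)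
  have hsu : ‖star u‖ = 1 := by rw [Quaternion.norm_star]; exact hu
  set X : Fin 3 → ℝ := rot3 (star u) x with hX
  set Y : Fin 3 → ℝ := rot3 (star u) y with hY
  set Z : Fin 3 → ℝ := rot3 (star u) z with hZ
  have hXe : X = ![Real.sqrt Nx, 0, 0] := by rw [hX, rot3_star_self_axis hu hxN hrot, hNxe]
  have hY0 : Y 0 = (Real.sqrt Nx)⁻¹ * (x 0 * y 0 + x 1 * y 1 + x 2 * y 2) := by rw [hY, rot3_star_other_axial hu hrot, hNxe]
  have hYt : (Y 1) ^ 2 + (Y 2) ^ 2 = ((x 1 * y 2 - x 2 * y 1) ^ 2 + (x 2 * y 0 - x 0 * y 2) ^ 2 + (x 0 * y 1 - x 1 * y 0) ^ 2) / Nx := by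
    rw [hY, rot3_star_other_transverse_sq hu hxN hrot, hNxe]
  have hYN : (Y 0) ^ 2 + (Y 1) ^ 2 + (Y 2) ^ 2 = Ny := by rw [← normSq3_eq_three', hY, normSq3_rot3 hsu, normSq3_eq_three']
  have hZN : (Z 0) ^ 2 + (Z 1) ^ 2 + (Z 2) ^ 2 = Nz := by rw [← normSq3_eq_three', hZ, normSq3_rot3 hsu, normSq3_eq_three']
  have hrotℓ : gnoRot (star u) ℓ = (((X, Y), (Z, (0 : Fol L → Fin 3 → ℝ))) : GnoCoord L) := by rw [hℓ, gnoRot_leaderPoint]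
  have hbase : gnoBase (L := L) p'.1 p'.2 = ((((![X 0, 0, 0] : Fin 3 → ℝ), (![Y 0, 0, 0] : Fin 3 → ℝ)), ((0 : Fin 3 → ℝ), (0 : Fol L → Fin 3 → ℝ))) : GnoCoord L) := by
    rw [gnoBase_eq_leaders, hXe, hY0]; rfl
  have hD : ∀ μ' : Fin 4, ‖su2Quat ((blowUpPoint (L := L) 1 (gnomonicPoint ((1 : ℝ) : ℍ) ε (gnoBase p'.1 p'.2))).1 μ') -
      su2Quat ((blowUpPoint (L := L) 1 (gnomonicPoint ((1 : ℝ) : ℍ) ε (gnoRot (star u) ℓ))).1 μ')‖ ≤ ω₀ := by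
    intro μ'
    rw [hrotℓ, hbase]
    refine (leaderGroupDist_le_apex ε X Y Z 0 0 μ').trans ?_
    have e1 : Real.sqrt (2 * ((X 1) ^ 2 + (X 2) ^ 2) / (1 + ((X 0) ^ 2 + (X 1) ^ 2 + (X 2) ^ 2))) = 0 := by
      rw [hXe]; simp
    have e2 : Real.sqrt (2 * ((Z 0) ^ 2 + (Z 1) ^ 2 + (Z 2) ^ 2) / (1 + ((Z 0) ^ 2 + (Z 1) ^ 2 + (Z 2) ^ 2))) ≤ Real.sqrt (2 * θ2) := by
      rw [hZN]
      refine Real.sqrt_le_sqrt ?_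
      rw [mul_div_assoc]
      exact mul_le_mul_of_nonneg_left hzt (by norm_num)
    have e3 : Real.sqrt (2 * ((Y 1) ^ 2 + (Y 2) ^ 2) / (1 + ((Y 0) ^ 2 + (Y 1) ^ 2 + (Y 2) ^ 2))) ≤ Real.sqrt (2 * θ') := by
      rw [hYN]
      refine Real.sqrt_le_sqrt ?_
      have hT0 : 0 ≤ (Y 1) ^ 2 + (Y 2) ^ 2 := by positivity
      have hTM : (Y 1) ^ 2 + (Y 2) ^ 2 ≤ Ny := by rw [← hYN]; linarith only [sq_nonneg (Y 0)]
      have hCr' : 4 * (Nx * ((Y 1) ^ 2 + (Y 2) ^ 2)) / ((1 + Nx) * (1 + Ny)) ≤ θ' ^ 2 := by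
        have e : Nx * ((Y 1) ^ 2 + (Y 2) ^ 2) = (x 1 * y 2 - x 2 * y 1) ^ 2 + (x 2 * y 0 - x 0 * y 2) ^ 2 + (x 0 * y 1 - x 1 * y 0) ^ 2 := by
          rw [hYt, mul_div_cancel₀ _ hx.ne']
        rw [e]; exact hCrθ
      exact transverse_window_of_cross hx (by positivity) hT0 hTM hyx hθ'0 hθ'1 hCr'
    calc Real.sqrt (2 * ((X 1) ^ 2 + (X 2) ^ 2) / (1 + ((X 0) ^ 2 + (X 1) ^ 2 + (X 2) ^ 2))) +
          Real.sqrt (2 * ((Z 0) ^ 2 + (Z 1) ^ 2 + (Z 2) ^ 2) / (1 + ((Z 0) ^ 2 + (Z 1) ^ 2 + (Z 2) ^ 2))) +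
          Real.sqrt (2 * ((Y 1) ^ 2 + (Y 2) ^ 2) / (1 + ((Y 0) ^ 2 + (Y 1) ^ 2 + (Y 2) ^ 2)))
        ≤ 0 + Real.sqrt (2 * θ2) + Real.sqrt (2 * θ') := by rw [e1]; exact add_le_add (add_le_add le_rfl e2) e3
      _ ≤ ω₀ := by rw [zero_add, hθ2, hθ']; exact hθwin
  -- the near bound of ✓`tipFibre_le_four_cross`, floor weakened
  set Four : ℝ := 4 * δt ^ 2 * ((1 + δt ^ 2)⁻¹) ^ 2 * ((x 1) ^ 2 + (x 2) ^ 2) / (1 + Nx) +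
          4 * (1 + δt ^ 2)⁻¹ * ((y 1) ^ 2 + (y 2) ^ 2) / (1 + Ny) +
          4 * ((x 2 * y 0 - x 0 * y 2) ^ 2 + (x 0 * y 1 - x 1 * y 0) ^ 2) / ((1 + Nx) * (1 + Ny)) + Nz / (1 + Nz) with hFour
  have hT : ∫⁻ F : Fol L → Fin 3 → ℝ, ENNReal.ofReal (Real.exp (-(b * gnoDeficit (fun _ => false) (fun _ => 1) (hubAt δt 1) ε (((x, y), (z, F)) : GnoCoord L))) * piWeight F) ≤
      ENNReal.ofReal (Real.exp (-(b * (Four / (14400 * (L : ℝ) ^ 6) + Cr / (3600 * (L : ℝ) ^ 6)))) * Kn) + Tfar :=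
    tipFibre_le_four_cross hε hδt0 hwinδ hA0s hA0yy hA0ray hA0amb x y z hsT hκf0.le hs2 hκf hκwin hu p' hω0 hω1 hD hDwin hb
  set A1 : ℝ := 2 * (1 + δt ^ 2)⁻¹ * ((x 1) ^ 2 + (x 2) ^ 2) / (1 + Nx) with hA1
  have hcoef : 2 * (1 + δt ^ 2)⁻¹ ≤ 4 * δt ^ 2 * ((1 + δt ^ 2)⁻¹) ^ 2 := two_sSq_le_four_deltaSq_sSq_sq hδt
  have hA1le : A1 ≤ 4 * δt ^ 2 * ((1 + δt ^ 2)⁻¹) ^ 2 * ((x 1) ^ 2 + (x 2) ^ 2) / (1 + Nx) := by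
    rw [hA1]
    exact div_le_div_of_nonneg_right (mul_le_mul_of_nonneg_right hcoef (by positivity)) (by positivity)
  have hzz : Nz / 2 ≤ Nz / (1 + Nz) := div_le_div_of_nonneg_left hNz0 (by positivity) (by linarith only [hNz1])
  have key : A1 + Nz / 2 ≤ Four := by rw [hFour]; linarith only [hA1le, hzz, ht2, ht3]
  have hexp : Real.exp (-(b * (Four / (14400 * (L : ℝ) ^ 6) + Cr / (3600 * (L : ℝ) ^ 6)))) ≤
      Real.exp (-(b / (14400 * (L : ℝ) ^ 6) * A1)) * Real.exp (-(b / (28800 * (L : ℝ) ^ 6) * Nz)) * Real.exp (-(b / (3600 * (L : ℝ) ^ 6) * Cr)) := by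
    rw [← Real.exp_add, ← Real.exp_add]
    refine Real.exp_le_exp.2 ?_
    have hdiff : -(b / (14400 * (L : ℝ) ^ 6) * A1) + -(b / (28800 * (L : ℝ) ^ 6) * Nz) + -(b / (3600 * (L : ℝ) ^ 6) * Cr) -
        -(b * (Four / (14400 * (L : ℝ) ^ 6) + Cr / (3600 * (L : ℝ) ^ 6))) = b / (14400 * (L : ℝ) ^ 6) * (Four - A1 - Nz / 2) := by ring
    have hpos : 0 ≤ b / (14400 * (L : ℝ) ^ 6) * (Four - A1 - Nz / 2) := mul_nonneg (by positivity) (by linarith only [key])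
    linarith only [hdiff, hpos]
  calc ∫⁻ F : Fol L → Fin 3 → ℝ, ENNReal.ofReal (Real.exp (-(b * gnoDeficit (fun _ => false) (fun _ => 1) (hubAt δt 1) ε (((x, y), (z, F)) : GnoCoord L))) * piWeight F)
      ≤ ENNReal.ofReal (Real.exp (-(b * (Four / (14400 * (L : ℝ) ^ 6) + Cr / (3600 * (L : ℝ) ^ 6)))) * Kn) + Tfar := hT
    _ ≤ ENNReal.ofReal (Real.exp (-(b / (14400 * (L : ℝ) ^ 6) * A1)) * Real.exp (-(b / (28800 * (L : ℝ) ^ 6) * Nz)) *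
          Real.exp (-(b / (3600 * (L : ℝ) ^ 6) * Cr)) * Kn) + Tfar :=
        add_le_add (ENNReal.ofReal_le_ofReal (mul_le_mul_of_nonneg_right hexp hKn0)) le_rfl

end Summit.QuantumFields.YangMills.Theorems.SwapVirialDeficit.SectorLaplace

end
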